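import Literature.Probability.RandomPlanarGeometry.SAWTriangularFiniteMemory
import Mathlib.Data.List.Lex
import Mathlib.Data.Finset.Max
import HarnessLib

/-!
# The symmetry-reduced Pönitz–Tittmann certificate on the triangular lattice: `μ(𝕋) ≤ N/D` from normal forms

Topic `Literature/Probability/RandomPlanarGeometry` (continues `SAWTriangularFiniteMemory.lean`; the
triangular-lattice twin of `SAWFiniteMemorySymm.lean`). The memory-`K` automaton `TriFiniteMemory.ptStep K`
on `𝕋` has `293 767` reachable states for `K = 11`, `1 056 733` for `K = 12` and about `3.8 · 10⁶` for
`K = 13`, too many for one kernel evaluation of the unreduced check beyond `K = 11`. As in Pönitz–Tittmann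
(2000), §3 ("we exploit this kind of symmetry by normalizing states"), the automaton is reduced by the point
group of the lattice — here the TWELVE symmetries of `𝕋` fixing the origin (rotations by multiples of `60°`
and six reflections), which act on the cyclically ordered step alphabet `TriStep = Fin 6` by `d ↦ r + d` and
`d ↦ r − d`:
* `syms` (the twelve permutations), `phiP g` the induced linear automorphism of `ℤ²`, and **`ptStep_map`**:
  `ptStep K (g·a) (g d) = g·(ptStep K a d)` (the automaton's rule is stated in the graph distance `dist_𝕋`,
  which the symmetries preserve: `distT_phiP`);
* `canon a` — the normal form (lexicographically least of the twelve images): `exists_canon_eq`, `canon_map`;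
* `checkC K N D iters` — executable reduced check over NORMAL FORMS (`K = 12`: `88 065`; `K = 13`: `320 459`;
  `K = 14`: `1 178 071`), verified part `verifyC` (closure and the Collatz–Wielandt inequalities for the
  SYMMETRIC weight `a ↦ v(canon a)` at every tabulated normal form);
* `certificate_of_verifyC` (soundness, by equivariance), `triSawCount_mul_pow_le_of_checkC` and
  **`exp_logMuTri_le_of_checkC : checkC K N D iters = true → μ(𝕋) ≤ N/D`**.
The evaluations in the tree are `K = 11` (`μ(𝕋) ≤ 4.281`, `SAWTriangularFiniteMemory11.lean`) and `K = 12` (`μ(𝕋) ≤ 4.271`,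
`SAWTriangularFiniteMemory12.lean`, `exp_logMuTri_le_4271`), one `native_decide` each over this file's `checkC`; a `K = 13`
evaluation (`≈ 4.262`, `320 459` normal forms) is ANNOUNCED ONLY — sized but not certified, no such tree file.

## References

* A. Pönitz, P. Tittmann, *Improved upper bounds for self-avoiding walks in ℤᵈ*, Electron. J.
  Combin. 7 (2000) R21, §2 (automaton), §3 (normalizing states; eigenvalue bound) [PonitzTittmann2000].
* S. E. Alm, *Upper and lower bounds for the connective constants of self-avoiding walks on the Archimedean
  and Laves lattices*, J. Phys. A 38 (2005) 2055–2080, §5.5.1 (`μ(𝕋) < 4.251419`, the printed record).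
-/


open Finset Filter Topology Literature.Probability.LatticeModels BigOperators

namespace Literature.Probability.RandomPlanarGeometry.SAW

namespace TriFiniteMemory

/-! ### The twelve lattice symmetries on the step alphabet -/

/-- Rotation of the step alphabet: `d ↦ r + d` (`r = 1` is the rotation by `60°`). [cite: PonitzTittmann2000, §3] -/
def rot (r : Fin 6) : TriStep → TriStep := fun d => r + d

/-- `rot` unfolds. [cite: PonitzTittmann2000, §3] -/
@[simp] theorem rot_apply (r d : Fin 6) : rot r d = r + d := rfl

/-- Reflection of the step alphabet: `d ↦ r - d` (`r = 0` fixes the direction `(1,0)`). [cite: PonitzTittmann2000, §3] -/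
def refl (r : Fin 6) : TriStep → TriStep := fun d => r - d

/-- `refl` unfolds. [cite: PonitzTittmann2000, §3] -/
@[simp] theorem refl_apply (r d : Fin 6) : refl r d = r - d := rfl

/-- The point group of the triangular lattice as twelve permutations of the step alphabet.
[cite: PonitzTittmann2000, §3] -/
def syms : List (TriStep → TriStep) :=
  [rot 0, rot 1, rot 2, rot 3, rot 4, rot 5, refl 0, refl 1, refl 2, refl 3, refl 4, refl 5]

/-- Membership in `syms`, as a twelve-way disjunction (for case analysis). [cite: PonitzTittmann2000, §3] -/
private theorem mem_syms {g : TriStep → TriStep} (hg : g ∈ syms) :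
    g = rot 0 ∨ g = rot 1 ∨ g = rot 2 ∨ g = rot 3 ∨ g = rot 4 ∨ g = rot 5 ∨
      g = refl 0 ∨ g = refl 1 ∨ g = refl 2 ∨ g = refl 3 ∨ g = refl 4 ∨ g = refl 5 := by
  simpa [syms] using hg

/-- The twelve images of a step word under the lattice symmetries. [cite: PonitzTittmann2000, §3] -/
def images (a : List TriStep) : List (List TriStep) := syms.map fun g => a.map g

/-- The images form a nonempty finset. [cite: PonitzTittmann2000, §3] -/
private theorem images_toFinset_nonempty (a : List TriStep) : (images a).toFinset.Nonempty :=
  ⟨a.map (rot 0), by simp [images, syms]⟩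

/-- **Normal form of a state**: the lexicographically least of its twelve images ("normalizing states",
Pönitz–Tittmann §3), computed by a fold of `min` over the images (`canon_eq_min'`: it is the `min'` of
the finset of images). [cite: PonitzTittmann2000, §3] -/
def canon (a : List TriStep) : List TriStep := (images a).foldl min (a.map (rot 0))

/-- A fold of `min` from `b` over `l` is `b` or a member of `l`. [cite: PonitzTittmann2000, §3] -/
private theorem foldl_min_mem {β : Type*} [LinearOrder β] (l : List β) (b : β) :
    l.foldl min b = b ∨ l.foldl min b ∈ l := by
  induction l generalizing b with
  | nil => simp
  | cons x l ih =>
    rw [List.foldl_cons]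
    rcases ih (min b x) with h | h
    · rw [h]
      rcases min_choice b x with h' | h'
      · exact Or.inl h'
      · exact Or.inr (by rw [h']; exact List.mem_cons_self)
    · exact Or.inr (List.mem_cons_of_mem _ h)

/-- A fold of `min` from `b` over `l` is below `b` and below every member of `l`. [cite: PonitzTittmann2000, §3] -/
private theorem foldl_min_le {β : Type*} [LinearOrder β] (l : List β) (b : β) :
    l.foldl min b ≤ b ∧ ∀ x ∈ l, l.foldl min b ≤ x := by
  induction l generalizing b with
  | nil => simp
  | cons x l ih =>
    rw [List.foldl_cons]
    obtain ⟨h1, h2⟩ := ih (min b x)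
    refine ⟨h1.trans (min_le_left _ _), fun y hy => ?_⟩
    rcases List.mem_cons.1 hy with rfl | hy
    · exact h1.trans (min_le_right _ _)
    · exact h2 y hy

/-- The normal form is one of the images (list form). [cite: PonitzTittmann2000, §3] -/
private theorem canon_mem_images (a : List TriStep) : canon a ∈ images a := by
  rcases foldl_min_mem (images a) (a.map (rot 0)) with h | h
  · rw [canon, h]; simp [images, syms]
  · exact h

/-- The normal form is the least element of the finset of images. [cite: PonitzTittmann2000, §3] -/
private theorem canon_eq_min' (a : List TriStep) :
    canon a = (images a).toFinset.min' (images_toFinset_nonempty a) := by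
  refine le_antisymm ?_ (Finset.min'_le _ _ (List.mem_toFinset.2 (canon_mem_images a)))
  refine Finset.le_min' _ _ _ fun y hy => ?_
  exact (foldl_min_le (images a) (a.map (rot 0))).2 y (List.mem_toFinset.1 hy)

/-! ### The symmetry-reduced certificate: untrusted search -/

/-- Breadth-first enumeration of the normal forms of the states reachable from `[]` (fuelled;
untrusted — only its output is checked). [cite: PonitzTittmann2000, §3] -/
def bfsC (K : ℕ) : Array (List TriStep) × Std.HashMap (List TriStep) ℕ := Id.run do
  let mut states : Array (List TriStep) := #[[]]
  let mut idx : Std.HashMap (List TriStep) ℕ := (Std.HashMap.emptyWithCapacity 1000000).insert [] 0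
  let mut i := 0
  let mut fuel := 20000000
  while i < states.size && fuel > 0 do
    fuel := fuel - 1
    let a := states[i]!
    for d in List.finRange 6 do
      match ptStep K a d with
      | none => pure ()
      | some b =>
        let c := canon b
        if !idx.contains c then
          idx := idx.insert c states.size
          states := states.push c
    i := i + 1
  return (states, idx)

/-- Successor indices (of the normal forms) of every tabulated state (untrusted). [cite: PonitzTittmann2000, §3] -/
def transTableC (K : ℕ) (states : Array (List TriStep)) (idx : Std.HashMap (List TriStep) ℕ) :
    Array (Array ℕ) :=
  states.map fun a => Id.run do
    let mut acc : Array ℕ := #[]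
    for d in List.finRange 6 do
      match ptStep K a d with
      | none => pure ()
      | some b => acc := acc.push (idx.getD (canon b) 0)
    return acc

/-- The reduced search: normal-form states, index, proposed weights (untrusted).
[cite: PonitzTittmann2000, §3] -/
def searchC (K iters : ℕ) : Array (List TriStep) × Std.HashMap (List TriStep) ℕ × Array ℕ :=
  let (states, idx) := bfsC K
  (states, idx, FiniteMemory.powerIter (transTableC K states idx) iters)

/-! ### The symmetry-reduced certificate: verified check -/

/-- The symmetric weight function encoded by the arrays: `v[idx[canon a]]`. [cite: PonitzTittmann2000, §3] -/
def weightC (idx : Std.HashMap (List TriStep) ℕ) (v : Array ℕ) (a : List TriStep) : ℕ :=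
  weightOf idx v (canon a)

/-- Check of the tabulated state number `i`: consistent index, the state is a normal form,
positive weight, normal forms of the successors in the table, Collatz–Wielandt inequality for the
symmetric weight. [cite: PonitzTittmann2000, §3] -/
def verifyStateC (K N D : ℕ) (states : Array (List TriStep)) (idx : Std.HashMap (List TriStep) ℕ)
    (v : Array ℕ) (i : ℕ) : Bool :=
  match states[i]?, v[i]? with
  | some a, some vi =>
    decide (idx[a]? = some i) && decide (canon a = a) && decide (1 ≤ vi) &&
      (List.finRange 6).all (fun d =>
        match ptStep K a d with
        | none => true
        | some b =>
          match idx[canon b]? with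
          | none => false
          | some j => decide (states[j]? = some (canon b))) &&
      decide (D * (List.ofFn fun d : TriStep => ((ptStep K a d).map (weightC idx v)).getD 0).sum
        ≤ N * vi)
  | _, _ => false

/-- The verified part of the reduced certificate check. [cite: PonitzTittmann2000, §3] -/
def verifyC (K N D : ℕ) (states : Array (List TriStep)) (idx : Std.HashMap (List TriStep) ℕ)
    (v : Array ℕ) : Bool :=
  decide (states[0]? = some []) && decide (weightC idx v [] ≤ 2 ^ 41) &&
    (List.range states.size).all (verifyStateC K N D states idx v)

/-- **The symmetry-reduced certificate check** `checkC K N D iters`: reduced search, then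
verify. Only ever evaluated by `native_decide`. [cite: PonitzTittmann2000, §3] -/
@[irreducible] def checkC (K N D iters : ℕ) : Bool :=
  let r := searchC K iters
  verifyC K N D r.1 r.2.1 r.2.2

/-! ### Geometry of the symmetries -/

/-- The linear map of `ℤ²` induced by a symmetry `g` of the step alphabet: it sends the basis steps
`vec 0 = e₀`, `vec 1 = e₁` to the steps `vec (g 0)`, `vec (g 1)`. [cite: PonitzTittmann2000, §3] -/
def phiP (g : TriStep → TriStep) (p : ℤ × ℤ) : ℤ × ℤ :=
  (p.1 * TriStep.dx (g 0) + p.2 * TriStep.dx (g 1), p.1 * TriStep.dy (g 0) + p.2 * TriStep.dy (g 1))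

/-- `phiP g` fixes the origin. [cite: PonitzTittmann2000, §3] -/
@[simp] private theorem phiP_zero (g : TriStep → TriStep) : phiP g (0, 0) = (0, 0) := by simp [phiP]

/-- The twelve symmetries are linear on the six step vectors: `vec (g d) = dx d · vec (g 0) + dy d · vec (g 1)`,
coordinatewise (decided on `Fin 6`). [cite: PonitzTittmann2000, §3] -/
private theorem syms_linear {g : TriStep → TriStep} (hg : g ∈ syms) : ∀ d : TriStep,
    TriStep.dx d * TriStep.dx (g 0) + TriStep.dy d * TriStep.dx (g 1) = TriStep.dx (g d) ∧
      TriStep.dx d * TriStep.dy (g 0) + TriStep.dy d * TriStep.dy (g 1) = TriStep.dy (g d) := by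
  obtain rfl | rfl | rfl | rfl | rfl | rfl | rfl | rfl | rfl | rfl | rfl | rfl := mem_syms hg <;> decide

/-- **Equivariance of one step**: `phiP g (p + e_d) = phiP g p + e_{g d}` for the twelve symmetries.
[cite: PonitzTittmann2000, §3] -/
private theorem phiP_pxy {g : TriStep → TriStep} (hg : g ∈ syms) (d : TriStep) (p : ℤ × ℤ) :
    phiP g (pxy d p) = pxy (g d) (phiP g p) := by
  obtain ⟨h1, h2⟩ := syms_linear hg d
  obtain ⟨x, y⟩ := p
  simp only [phiP, pxy_eq, Prod.mk.injEq]
  constructor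
  · rw [← h1]; ring
  · rw [← h2]; ring

/-- The values of a symmetry on the basis steps, as the six integers `dx (g 0), dy (g 0), dx (g 1), dy (g 1)`:
one of twelve explicit quadruples. [cite: PonitzTittmann2000, §3] -/
private theorem syms_basis {g : TriStep → TriStep} (hg : g ∈ syms) :
    (TriStep.dx (g 0) = 1 ∧ TriStep.dy (g 0) = 0 ∧ TriStep.dx (g 1) = 0 ∧ TriStep.dy (g 1) = 1) ∨
    (TriStep.dx (g 0) = 0 ∧ TriStep.dy (g 0) = 1 ∧ TriStep.dx (g 1) = -1 ∧ TriStep.dy (g 1) = 1) ∨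
    (TriStep.dx (g 0) = -1 ∧ TriStep.dy (g 0) = 1 ∧ TriStep.dx (g 1) = -1 ∧ TriStep.dy (g 1) = 0) ∨
    (TriStep.dx (g 0) = -1 ∧ TriStep.dy (g 0) = 0 ∧ TriStep.dx (g 1) = 0 ∧ TriStep.dy (g 1) = -1) ∨
    (TriStep.dx (g 0) = 0 ∧ TriStep.dy (g 0) = -1 ∧ TriStep.dx (g 1) = 1 ∧ TriStep.dy (g 1) = -1) ∨
    (TriStep.dx (g 0) = 1 ∧ TriStep.dy (g 0) = -1 ∧ TriStep.dx (g 1) = 1 ∧ TriStep.dy (g 1) = 0) ∨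
    (TriStep.dx (g 0) = 1 ∧ TriStep.dy (g 0) = 0 ∧ TriStep.dx (g 1) = 1 ∧ TriStep.dy (g 1) = -1) ∨
    (TriStep.dx (g 0) = 0 ∧ TriStep.dy (g 0) = 1 ∧ TriStep.dx (g 1) = 1 ∧ TriStep.dy (g 1) = 0) ∨
    (TriStep.dx (g 0) = -1 ∧ TriStep.dy (g 0) = 1 ∧ TriStep.dx (g 1) = 0 ∧ TriStep.dy (g 1) = 1) ∨
    (TriStep.dx (g 0) = -1 ∧ TriStep.dy (g 0) = 0 ∧ TriStep.dx (g 1) = -1 ∧ TriStep.dy (g 1) = 1) ∨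
    (TriStep.dx (g 0) = 0 ∧ TriStep.dy (g 0) = -1 ∧ TriStep.dx (g 1) = -1 ∧ TriStep.dy (g 1) = 0) ∨
    (TriStep.dx (g 0) = 1 ∧ TriStep.dy (g 0) = -1 ∧ TriStep.dx (g 1) = 0 ∧ TriStep.dy (g 1) = -1) := by
  obtain rfl | rfl | rfl | rfl | rfl | rfl | rfl | rfl | rfl | rfl | rfl | rfl := mem_syms hg <;> decide

/-- The twelve symmetries are `dist_𝕋`-isometries. [cite: PonitzTittmann2000, §3] -/
theorem distT_phiP {g : TriStep → TriStep} (hg : g ∈ syms) (p q : ℤ × ℤ) :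
    distT (phiP g p) (phiP g q) = distT p q := by
  obtain ⟨x, y⟩ := p; obtain ⟨x', y'⟩ := q
  have hb := syms_basis hg
  simp only [phiP, distT, normT]
  rcases hb with ⟨h1, h2, h3, h4⟩ | ⟨h1, h2, h3, h4⟩ | ⟨h1, h2, h3, h4⟩ | ⟨h1, h2, h3, h4⟩ |
      ⟨h1, h2, h3, h4⟩ | ⟨h1, h2, h3, h4⟩ | ⟨h1, h2, h3, h4⟩ | ⟨h1, h2, h3, h4⟩ | ⟨h1, h2, h3, h4⟩ |
      ⟨h1, h2, h3, h4⟩ | ⟨h1, h2, h3, h4⟩ | ⟨h1, h2, h3, h4⟩ <;>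
    (rw [h1, h2, h3, h4]; omega)

/-- The twelve symmetries are injective on `ℤ²`. [cite: PonitzTittmann2000, §3] -/
private theorem phiP_injective {g : TriStep → TriStep} (hg : g ∈ syms) : Function.Injective (phiP g) := by
  intro p q h
  have h0 : distT (phiP g p) (phiP g q) = 0 := by rw [h]; simp [distT, normT]
  rw [distT_phiP hg] at h0
  obtain ⟨x, y⟩ := p; obtain ⟨x', y'⟩ := q
  simp only [distT, normT, Prod.mk.injEq] at h0 ⊢; omega

/-- Endpoint of the image word. [cite: PonitzTittmann2000, §3] -/
private theorem pEnd_map {g : TriStep → TriStep} (hg : g ∈ syms) (a : List TriStep) :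
    pEnd (a.map g) = phiP g (pEnd a) := by
  suffices key : ∀ s : ℤ × ℤ, (a.map g).foldl (fun p d => pxy d p) (phiP g s) =
      phiP g (a.foldl (fun p d => pxy d p) s) by
    have := key (0, 0); rw [phiP_zero] at this; exact this
  induction a with
  | nil => intro s; rfl
  | cons d a ih => intro s; rw [List.map_cons, List.foldl_cons, List.foldl_cons, ← phiP_pxy hg, ih]

/-- Vertices of the image word. [cite: PonitzTittmann2000, §3] -/
private theorem pVerts_map {g : TriStep → TriStep} (hg : g ∈ syms) (a : List TriStep) :
    pVerts (a.map g) = (pVerts a).map (phiP g) := by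
  suffices key : ∀ s : ℤ × ℤ, (a.map g).scanl (fun p d => pxy d p) (phiP g s) =
      (a.scanl (fun p d => pxy d p) s).map (phiP g) by
    have := key (0, 0); rw [phiP_zero] at this; exact this
  induction a with
  | nil => intro s; rfl
  | cons d a ih =>
    intro s; rw [List.map_cons, List.scanl_cons, List.scanl_cons, List.map_cons, ← phiP_pxy hg, ih]

/-- **Equivariance of the Pönitz–Tittmann automaton on `𝕋`** under the lattice symmetries:
`ptStep K (g·a) (g d) = g·(ptStep K a d)`. [cite: PonitzTittmann2000, §3] -/
theorem ptStep_map {g : TriStep → TriStep} (hg : g ∈ syms) (K : ℕ) (a : List TriStep) (d : TriStep) :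
    ptStep K (a.map g) (g d) = (ptStep K a d).map (List.map g) := by
  unfold ptStep
  simp only [pEnd_map hg, pVerts_map hg, ← phiP_pxy hg, List.length_map]
  have hmem : (phiP g (pxy d (pEnd a)) ∈ (pVerts a).map (phiP g)) ↔ pxy d (pEnd a) ∈ pVerts a := by
    rw [List.mem_map]
    exact ⟨fun ⟨q, hq, he⟩ => by rw [← phiP_injective hg he]; exact hq, fun h => ⟨_, h, rfl⟩⟩
  by_cases h : pxy d (pEnd a) ∈ pVerts a
  · rw [if_pos (hmem.2 h), if_pos h]; rfl
  · rw [if_neg (fun h' => h (hmem.1 h')), if_neg h, Option.map_some]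
    congr 1
    have hp : ((fun pi : (ℤ × ℤ) × ℕ => decide (K < a.length + 1 - pi.2 + distT pi.1 (phiP g (pxy d (pEnd a))))) ∘
        Prod.map (phiP g) id) =
        (fun pi : (ℤ × ℤ) × ℕ => decide (K < a.length + 1 - pi.2 + distT pi.1 (pxy d (pEnd a)))) := by
      funext pi
      simp only [Function.comp_apply, Prod.map_fst, Prod.map_snd, id_eq, distT_phiP hg]
    rw [List.zipIdx_map, List.takeWhile_map, List.length_map, hp,
      show List.map g a ++ [g d] = (a ++ [d]).map g by simp, List.map_drop]

/-! ### Group-theoretic facts about the twelve symmetries (decided on `Fin 6`) -/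

/-- Closure under composition, pointwise form. [cite: PonitzTittmann2000, §3] -/
private theorem syms_comp {g h : TriStep → TriStep} (hg : g ∈ syms) (hh : h ∈ syms) :
    ∃ k ∈ syms, ∀ d : TriStep, k d = h (g d) := by
  obtain rfl | rfl | rfl | rfl | rfl | rfl | rfl | rfl | rfl | rfl | rfl | rfl := mem_syms hg <;>
    obtain rfl | rfl | rfl | rfl | rfl | rfl | rfl | rfl | rfl | rfl | rfl | rfl := mem_syms hh <;> decide

/-- Right division, pointwise form. [cite: PonitzTittmann2000, §3] -/
private theorem syms_div {g k : TriStep → TriStep} (hg : g ∈ syms) (hk : k ∈ syms) :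
    ∃ h ∈ syms, ∀ d : TriStep, h (g d) = k d := by
  obtain rfl | rfl | rfl | rfl | rfl | rfl | rfl | rfl | rfl | rfl | rfl | rfl := mem_syms hg <;>
    obtain rfl | rfl | rfl | rfl | rfl | rfl | rfl | rfl | rfl | rfl | rfl | rfl := mem_syms hk <;> decide

/-- Every symmetry has an inverse among the symmetries. [cite: PonitzTittmann2000, §3] -/
private theorem syms_inv {g : TriStep → TriStep} (hg : g ∈ syms) :
    ∃ g' ∈ syms, (∀ d : TriStep, g' (g d) = d) ∧ ∀ d : TriStep, g (g' d) = d := by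
  obtain rfl | rfl | rfl | rfl | rfl | rfl | rfl | rfl | rfl | rfl | rfl | rfl := mem_syms hg <;> decide

/-! ### The normal form -/

/-- Membership in the images. [cite: PonitzTittmann2000, §3] -/
private theorem mem_images {a b : List TriStep} : b ∈ images a ↔ ∃ g ∈ syms, b = a.map g := by
  simp only [images, List.mem_map, eq_comm]

/-- The images of an image are the images. [cite: PonitzTittmann2000, §3] -/
private theorem images_toFinset_map {g : TriStep → TriStep} (hg : g ∈ syms) (a : List TriStep) :
    (images (a.map g)).toFinset = (images a).toFinset := by
  ext b
  rw [List.mem_toFinset, List.mem_toFinset, mem_images, mem_images]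
  constructor
  · rintro ⟨h, hh, rfl⟩
    obtain ⟨k, hk, hkd⟩ := syms_comp hg hh
    exact ⟨k, hk, by rw [List.map_map]; exact List.map_congr_left fun d _ => (hkd d).symm⟩
  · rintro ⟨k, hk, rfl⟩
    obtain ⟨h, hh, hhd⟩ := syms_div hg hk
    exact ⟨h, hh, by rw [List.map_map]; exact List.map_congr_left fun d _ => (hhd d).symm⟩

/-- **The normal form is one of the images** ("normalizing states"). [cite: PonitzTittmann2000, §3] -/
theorem exists_canon_eq (a : List TriStep) : ∃ g ∈ syms, canon a = a.map g :=
  mem_images.1 (canon_mem_images a)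

/-- `min'` depends only on the finset. [cite: PonitzTittmann2000, §3] -/
private theorem min'_congr {s t : Finset (List TriStep)} (h : s = t) (hs : s.Nonempty)
    (ht : t.Nonempty) : s.min' hs = t.min' ht := by subst h; rfl

/-- **The normal form is invariant under the symmetries** ("states whose normalized representatives are
the same could be collected"). [cite: PonitzTittmann2000, §3] -/
theorem canon_map {g : TriStep → TriStep} (hg : g ∈ syms) (a : List TriStep) : canon (a.map g) = canon a := by
  rw [canon_eq_min', canon_eq_min']
  exact min'_congr (images_toFinset_map hg a) _ _

/-- The normal form of the empty word (the initial state is its own class). [cite: PonitzTittmann2000, §3] -/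
@[simp] theorem canon_nil : canon [] = [] := by
  obtain ⟨g, -, h⟩ := exists_canon_eq []
  rw [h, List.map_nil]

/-! ### Soundness of the reduced check -/

/-- **Soundness of `verifyC`**: a successful reduced check yields a Collatz–Wielandt certificate
for `ptStep K` on the set of states whose normal form is tabulated, with the symmetric weight
`a ↦ v[idx[canon a]]` and `weight([]) ≤ 2⁴¹`. [cite: PonitzTittmann2000, §3] -/
theorem certificate_of_verifyC {K N D : ℕ} {states : Array (List TriStep)}
    {idx : Std.HashMap (List TriStep) ℕ} {v : Array ℕ} (h : verifyC K N D states idx v = true) :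
    TriWordAutomaton.Certificate (ptStep K) {a | ∃ i < states.size, states[i]? = some (canon a)}
      (weightC idx v) N D ∧ weightC idx v [] ≤ 2 ^ 41 := by
  simp only [verifyC, Bool.and_eq_true, decide_eq_true_eq, List.all_eq_true, List.mem_range] at h
  obtain ⟨⟨h0, hroot⟩, hall⟩ := h
  -- unpack the check of a tabulated state
  have key : ∀ a : List TriStep, ∀ i < states.size, states[i]? = some a →
      idx[a]? = some i ∧ canon a = a ∧ 1 ≤ weightOf idx v a ∧
      (∀ d b, ptStep K a d = some b → ∃ j < states.size, states[j]? = some (canon b)) ∧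
      D * ∑ d : TriStep, ((ptStep K a d).map (weightC idx v)).getD 0 ≤ N * weightOf idx v a := by
    intro a i hi ha
    have hs := hall i hi
    unfold verifyStateC at hs
    rw [ha] at hs
    cases hv : v[i]? with
    | none => simp [hv] at hs
    | some vi =>
      simp only [hv, Bool.and_eq_true, decide_eq_true_eq, List.all_eq_true] at hs
      obtain ⟨⟨⟨⟨hidx, hcan⟩, hvi⟩, hsucc⟩, hcw⟩ := hs
      have hw : weightOf idx v a = vi := by simp [weightOf, hidx, hv]
      refine ⟨hidx, hcan, hw ▸ hvi, fun d b hb => ?_, ?_⟩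
      · have := hsucc d (List.mem_finRange d)
        rw [hb] at this
        cases hj : idx[canon b]? with
        | none => simp [hj] at this
        | some j =>
          simp only [hj, decide_eq_true_eq] at this
          exact ⟨j, (Array.getElem?_eq_some_iff.1 this).1, this⟩
      · rw [hw, ← List.sum_ofFn]
        exact hcw
  refine ⟨⟨?_, ?_, ?_, ?_⟩, by simpa [weightC] using hroot⟩
  · exact ⟨0, (Array.getElem?_eq_some_iff.1 h0).1, by rw [canon_nil]; exact h0⟩
  · rintro a ⟨i, hi, ha⟩ d b hb
    obtain ⟨g, hg, hga⟩ := exists_canon_eq a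
    have hstep : ptStep K (canon a) (g d) = some (b.map g) := by
      rw [hga, ptStep_map hg, hb, Option.map_some]
    obtain ⟨j, hj, hjb⟩ := (key _ i hi ha).2.2.2.1 (g d) (b.map g) hstep
    exact ⟨j, hj, by rw [canon_map hg] at hjb; exact hjb⟩
  · rintro a ⟨i, hi, ha⟩
    exact (key _ i hi ha).2.2.1
  · rintro a ⟨i, hi, ha⟩
    obtain ⟨g, hg, hga⟩ := exists_canon_eq a
    obtain ⟨g', hg', hinv1, hinv2⟩ := syms_inv hg
    have hcw := (key _ i hi ha).2.2.2.2
    -- the successor weights of `a` and of `canon a = g·a` agree up to the permutation `g` of `TriStep`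
    have hterm : ∀ d : TriStep, ((ptStep K a d).map (weightC idx v)).getD 0 =
        ((ptStep K (canon a) (g d)).map (weightC idx v)).getD 0 := by
      intro d
      rw [hga, ptStep_map hg]
      cases ptStep K a d with
      | none => rfl
      | some b => simp only [Option.map_some, Option.getD_some, weightC, canon_map hg]
    have hsum : ∑ d : TriStep, ((ptStep K a d).map (weightC idx v)).getD 0 =
        ∑ d : TriStep, ((ptStep K (canon a) d).map (weightC idx v)).getD 0 := by
      simp only [hterm]
      exact Equiv.sum_comp ⟨g, g', hinv1, hinv2⟩
        (fun d => ((ptStep K (canon a) d).map (weightC idx v)).getD 0)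
    rw [hsum]
    exact hcw

/-- **`c_n(𝕋) · Dⁿ ≤ Nⁿ · 2⁴¹`** from a successful reduced certificate check. [cite: PonitzTittmann2000, §3] -/
theorem triSawCount_mul_pow_le_of_checkC {K N D iters : ℕ} (h : checkC K N D iters = true) (n : ℕ) :
    triSawCount n * D ^ n ≤ N ^ n * 2 ^ 41 := by
  rw [checkC] at h
  obtain ⟨hc, hroot⟩ := certificate_of_verifyC h
  have h1 := TriWordAutomaton.triSawCount_mul_pow_le hc (run_ne_none_of_isTriSAW K) n
  rw [weightC, canon_nil] at h1 hroot
  exact le_trans h1 (Nat.mul_le_mul_left _ hroot)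

/-- **`μ(𝕋) ≤ N/D` from a successful reduced certificate check**: `exp logMuTri ≤ N/D`
(`c_{n+1}(𝕋) ≤ (2⁴¹ N/D) · (N/D)ⁿ` and `logMuTri_le_log_of_succ_le`). [cite: PonitzTittmann2000, §3] -/
theorem exp_logMuTri_le_of_checkC {K N D iters : ℕ} (h : checkC K N D iters = true) (hD : 0 < D) :
    Real.exp logMuTri ≤ (N : ℝ) / D := by
  -- `N > 0` since `c_1(𝕋) ≥ 1`
  have hN : 0 < N := by
    have h1 := triSawCount_mul_pow_le_of_checkC h 1
    have hc : 1 ≤ triSawCount 1 := one_le_triSawCount 1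
    rcases Nat.eq_zero_or_pos N with hN | hN
    · subst hN
      simp only [pow_one, zero_mul, nonpos_iff_eq_zero, mul_eq_zero] at h1
      omega
    · exact hN
  have hNDpos : (0 : ℝ) < (N : ℝ) / D := by positivity
  have hlog : logMuTri ≤ Real.log ((N : ℝ) / D) := by
    refine logMuTri_le_log_of_succ_le (A := (2 : ℝ) ^ 41 * ((N : ℝ) / D)) (B := (N : ℝ) / D)
      (by positivity) hNDpos fun n => ?_
    have h3 := triSawCount_mul_pow_le_of_checkC h (n + 1)
    have h4 : (triSawCount (n + 1) : ℝ) * (D : ℝ) ^ (n + 1) ≤ (N : ℝ) ^ (n + 1) * (2 : ℝ) ^ 41 := by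
      exact_mod_cast h3
    have hDpos : (0 : ℝ) < (D : ℝ) ^ (n + 1) := by positivity
    have e : (2 : ℝ) ^ 41 * ((N : ℝ) / D) * ((N : ℝ) / D) ^ n =
        (N : ℝ) ^ (n + 1) * 2 ^ 41 / (D : ℝ) ^ (n + 1) := by
      rw [div_pow]
      field_simp
      ring
    rw [e, le_div_iff₀ hDpos]
    exact h4
  calc Real.exp logMuTri ≤ Real.exp (Real.log ((N : ℝ) / D)) := Real.exp_le_exp.2 hlog
    _ = (N : ℝ) / D := Real.exp_log hNDpos

end TriFiniteMemory

end Literature.Probability.RandomPlanarGeometry.SAW
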